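import Literature.AlgebraicGeometry.AbelianSchemes.AbelianSchemeDualTransportDualIsogeny
import Literature.AlgebraicGeometry.AbelianSchemes.AbelianSchemeDualRingActionEquivariant
import Literature.AlgebraicGeometry.AbelianSchemes.AbelianSchemeDualTransportSlice
import HarnessLib

/-!
# The Rosati condition `ι(b̄) ≫ λ = λ ≫ ι(b)^∨` is TRANSPORTED along an isomorphism of tuples `(e, Ĥ_e)` — any base, any two
# dual pairs, no unit hypothesis (the generic-side bridge from the E-line tuple `ε^*𝓜.univ` to `(univ_η, dualPairOf|_η)`)

Topic `AlgebraicGeometry/AbelianSchemes`; namespace `Literature.AlgebraicGeometry.AbelianSchemes.AbelianSchemeOver.DualPair` (+ two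
`RingAction` corollaries).  THEOREMS ONLY (no definition, no structure, no instance, no named fact, no `sorry`); books 0.

Cell hodgecm-mathlib (D-0151), P6 «MOD programme», (s2-D)∕SP1-ρ∕λ «DualPair ∕ Polarization spread ADAPTER», piece (O1)(c) (B-p04 (g40),
sequel of ★ `AbelianSchemeHomExtSchematicallyDominant` p847200 = (O1)(a)(b) «Rosati descends from the generic fibre»).  On the road of
record (LEAD «M-29») the GEN spine reads `RGDInputsAt.rosati` for the LETTER's dual `dualPairOf hDUALS univ` on the stage `𝓨`; by ★
`RingAction.rosati_of_genericFibre` it suffices to know it on the generic fibre `𝓨_η`, where the tuple `(univ_η, act_η, dual_η, λ_η)` is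
ISOMORPHIC — not equal — to the E-line tuple `(P.A, ρ, P.D, P.pol.lam)` (`stub_E6`: Rosati holds there): an isomorphism of `S`-group
schemes `e : A′ ≅ A` intertwining the actions, the dual transport `Ĥ_e : Â′ ≅ Â` of ★ `AbelianSchemeDualTransport` between the two
(arbitrary!) dual pairs, and the `λ`-clause `λ′ ≫ Ĥ_e = e ≫ λ` ([MumfordFogartyKirwan1994] Def. 7.3, clauses (ii)–(iv) along `𝟙 S`).
This file proves that Rosati passes through such an isomorphism of tuples:
* **`comp_eq_comp_dualIsogenyOver_of_transport`** (atomic): for `e : A′.X ≅ A.X` (`IsMonHom e.hom`), dual pairs `D` of `A` and `D′`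
  of `A′`, `lam : A → Â`, `lam′ : A′ → Â′` with the `λ`-clause `lam′ ≫ Ĥ_e = e ≫ lam` (★ `hatTransportOver D D′ e`), and homomorphisms
  `α, β` of `A`, `α′, β′` of `A′` intertwined by `e` (`α′ ≫ e = e ≫ α`, `β′ ≫ e = e ≫ β`):
  `α ≫ lam = lam ≫ β^∨  ⟹  α′ ≫ lam′ = lam′ ≫ β′^∨` (duals ★ `dualIsogenyOver` w.r.t. `D, D` resp. `D′, D′`).  PROOF: `Ĥ_e` is an
  isomorphism (★ `isIso_hatTransportOver`), so cancel it on the right; `Ĥ_e = (e⁻¹)^∨` (★ `hatTransportOver_eq_dualIsogenyOver_inv`,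
  [MilneAV2008] I §8 «unique») and dualising the square `β ≫ e⁻¹ = e⁻¹ ≫ β′` (★ `dualIsogenyOver_comm_of_comm`, [MumfordAV1970] §15
  Thm. 1) gives `β′^∨ ≫ Ĥ_e = Ĥ_e ≫ β^∨`; `…_iff_of_transport` is the equivalence;
* **`comp_eq_comp_dualIsogenyOver_lamTransport`** — the same with `lam′ := lamTransport D D′ e e′ lam = e ≫ lam ≫ Ĥ_{e′}` (★
  `AbelianSchemeDualTransportSlice`), whose `λ`-clause holds by ★ `hatTransport_comp_hatTransport` (`lamTransport_comp_hatTransportOver`);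
* **`RingAction.rosati_of_transport`** ∕ **`RingAction.rosati_lamTransport`** — the `RGDInputsAt.rosati` shape for ring actions
  `act, act′` intertwined by `e` (`act′.i a ≫ e = e ≫ act.i a`): Rosati for `(A, act, D, lam)` at `(b, b′)` ⟹ Rosati for
  `(A′, act′, D′, lam′)` at `(b, b′)` ([RapoportSmithlingZhang2020Diagonal] §3.2; [Kottwitz1992] §5).
Everything over an ARBITRARY base `S`, for ARBITRARY dual pairs, with NO reducedness ∕ Noetherian ∕ unit (`𝒫|_{A×{ε}} ≅ 𝒪`) hypothesis —
only the hypothesis-free halves of the ★ dual calculus are used.  HC_CM is proved only modulo the printed citations (2 remaining named inputs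
hLiu418 24832, h413 24833) until rung 0 closes; this file is count-neutral and discharges none of them.

## References
* [MumfordFogartyKirwan1994] D. Mumford, J. Fogarty, F. Kirwan, *Geometric Invariant Theory*, 3rd ed. (1994), Ch. 7 §2 Definition 7.3
  (p. 130) (isomorphism of polarised abelian schemes: clauses on `X̂` and `λ`), Ch. 6 §2 (p. 121).
* [MilneAV2008] J. S. Milne, *Abelian Varieties* (v2.00, 2008), I §8 pp. 36–37 (uniqueness of the dual pair), I §9 Thm. 9.1 (p. 42).
* [MumfordAV1970] D. Mumford, *Abelian Varieties* (1970), §15 Thm. 1 (p. 143) (functoriality of `f ↦ f^∨`), §20 (pp. 189–190) (Rosati involution).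
* [RapoportSmithlingZhang2020Diagonal] M. Rapoport, B. Smithling, W. Zhang (2020), §3.2 (the Rosati condition of the PEL moduli problem).
* [Kottwitz1992] R. Kottwitz, *Points on some Shimura varieties over finite fields*, JAMS 5 (1992), §5 (pp. 389–391).
* Tree: ★ `AbelianSchemeDualTransport` (`hatTransportOver`, `isIso_hatTransportOver`, `hatTransport_comp_hatTransport`), ★
  `AbelianSchemeDualTransportDualIsogeny` (`hatTransportOver_eq_dualIsogenyOver_inv`), ★ `AbelianSchemeDualRingActionEquivariant`
  (`dualIsogenyOver_comm_of_comm`), ★ `AbelianSchemeDualTransportSlice` (`lamTransport`), ★ `AbelianSchemeDualIsogeny` (`dualIsogenyOver`).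
-/

set_option autoImplicit false

noncomputable section

universe u

open CategoryTheory CategoryTheory.Limits AlgebraicGeometry

namespace Literature.AlgebraicGeometry.AbelianSchemes

namespace AbelianSchemeOver

namespace DualPair

variable {S : Scheme.{u}} {A A' : AbelianSchemeOver S} (e : A'.X ≅ A.X) [IsMonHom e.hom] (D : A.DualPair) (D' : A'.DualPair)

/-- **`β′^∨ ≫ Ĥ_e = Ĥ_e ≫ β^∨`** for homomorphisms `β` of `A`, `β′` of `A′` intertwined by `e` (`β′ ≫ e = e ≫ β`): `Ĥ_e = (e⁻¹)^∨` and the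
dual of the square `β ≫ e⁻¹ = e⁻¹ ≫ β′`. [cite: MilneAV2008, I §8 pp. 36–37] [cite: MumfordAV1970, §15 Thm. 1 (p. 143)] -/
theorem dualIsogenyOver_comp_hatTransportOver (β : A.X ⟶ A.X) (β' : A'.X ⟶ A'.X) [IsMonHom β] [IsMonHom β']
    (hβ : β' ≫ e.hom = e.hom ≫ β) :
    dualIsogenyOver β' D' D' ≫ hatTransportOver D D' e = hatTransportOver D D' e ≫ dualIsogenyOver β D D := by
  have hsq : β ≫ e.inv = e.inv ≫ β' := by
    rw [← cancel_mono e.hom, Category.assoc, Category.assoc, e.inv_hom_id, Category.comp_id, hβ, e.inv_hom_id_assoc]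
  rw [hatTransportOver_eq_dualIsogenyOver_inv]
  exact (dualIsogenyOver_comm_of_comm e.inv D D' β β' hsq).symm

/-- **ROSATI IS TRANSPORTED ALONG AN ISOMORPHISM OF TUPLES** (atomic form): with the `λ`-clause `lam′ ≫ Ĥ_e = e ≫ lam` and `α, β`
(on `A`), `α′, β′` (on `A′`) intertwined by `e`, `α ≫ lam = lam ≫ β^∨ ⟹ α′ ≫ lam′ = lam′ ≫ β′^∨` — any base, any dual pairs `D, D′`.
[cite: MumfordFogartyKirwan1994, Ch. 7 §2 Definition 7.3 (p. 130)] [cite: RapoportSmithlingZhang2020Diagonal, §3.2] [cite: MilneAV2008, I §8 pp. 36–37] -/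
theorem comp_eq_comp_dualIsogenyOver_of_transport (lam : A.X ⟶ D.hat.X) (lam' : A'.X ⟶ D'.hat.X)
    (hlam : lam' ≫ hatTransportOver D D' e = e.hom ≫ lam)
    (α β : A.X ⟶ A.X) (α' β' : A'.X ⟶ A'.X) [IsMonHom β] [IsMonHom β']
    (hα : α' ≫ e.hom = e.hom ≫ α) (hβ : β' ≫ e.hom = e.hom ≫ β)
    (h : α ≫ lam = lam ≫ dualIsogenyOver β D D) :
    α' ≫ lam' = lam' ≫ dualIsogenyOver β' D' D' := by
  haveI : IsMonHom e.symm.hom := (inferInstance : IsMonHom e.inv)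
  haveI := isIso_hatTransportOver D D' e e.symm rfl
  rw [← cancel_mono (hatTransportOver D D' e)]
  calc (α' ≫ lam') ≫ hatTransportOver D D' e = α' ≫ (lam' ≫ hatTransportOver D D' e) := Category.assoc _ _ _
    _ = (α' ≫ e.hom) ≫ lam := by rw [hlam, Category.assoc]
    _ = e.hom ≫ (α ≫ lam) := by rw [hα, Category.assoc]
    _ = (e.hom ≫ lam) ≫ dualIsogenyOver β D D := by rw [h, Category.assoc]
    _ = lam' ≫ (hatTransportOver D D' e ≫ dualIsogenyOver β D D) := by rw [← hlam, Category.assoc]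
    _ = (lam' ≫ dualIsogenyOver β' D' D') ≫ hatTransportOver D D' e := by
        rw [← dualIsogenyOver_comp_hatTransportOver e D D' β β' hβ, Category.assoc]

/-- The converse direction packaged as an equivalence: under the `λ`-clause and the intertwinings, Rosati for `(A, D, lam)` at `(α, β)`
holds iff Rosati for `(A′, D′, lam′)` at `(α′, β′)` holds. [cite: MumfordFogartyKirwan1994, Ch. 7 §2 Definition 7.3 (p. 130)] [cite: RapoportSmithlingZhang2020Diagonal, §3.2] -/
theorem comp_eq_comp_dualIsogenyOver_iff_of_transport (lam : A.X ⟶ D.hat.X) (lam' : A'.X ⟶ D'.hat.X)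
    (hlam : lam' ≫ hatTransportOver D D' e = e.hom ≫ lam)
    (α β : A.X ⟶ A.X) (α' β' : A'.X ⟶ A'.X) [IsMonHom β] [IsMonHom β']
    (hα : α' ≫ e.hom = e.hom ≫ α) (hβ : β' ≫ e.hom = e.hom ≫ β) :
    α ≫ lam = lam ≫ dualIsogenyOver β D D ↔ α' ≫ lam' = lam' ≫ dualIsogenyOver β' D' D' := by
  refine ⟨comp_eq_comp_dualIsogenyOver_of_transport e D D' lam lam' hlam α β α' β' hα hβ, fun h' => ?_⟩
  -- transport back along `e⁻¹ : A ≅ A′`, whose dual transport is the inverse of `Ĥ_e`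
  haveI : IsMonHom e.symm.hom := (inferInstance : IsMonHom e.inv)
  haveI := isIso_hatTransportOver D D' e e.symm rfl
  have hH : hatTransportOver D' D e.symm ≫ hatTransportOver D D' e = 𝟙 _ :=
    Over.OverMorphism.ext (by
      rw [Over.comp_left, hatTransportOver_left, hatTransportOver_left, Over.id_left]
      exact hatTransport_comp_hatTransport D D' e e.symm rfl)
  have hlam' : lam ≫ hatTransportOver D' D e.symm = e.symm.hom ≫ lam' := by
    rw [← cancel_mono (hatTransportOver D D' e), Category.assoc, hH, Category.comp_id, Category.assoc, hlam, Iso.symm_hom,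
      e.inv_hom_id_assoc]
  have hα' : α ≫ e.symm.hom = e.symm.hom ≫ α' := by
    change α ≫ e.inv = e.inv ≫ α'
    rw [← cancel_mono e.hom, Category.assoc, Category.assoc, e.inv_hom_id, Category.comp_id, hα, e.inv_hom_id_assoc]
  have hβ' : β ≫ e.symm.hom = e.symm.hom ≫ β' := by
    change β ≫ e.inv = e.inv ≫ β'
    rw [← cancel_mono e.hom, Category.assoc, Category.assoc, e.inv_hom_id, Category.comp_id, hβ, e.inv_hom_id_assoc]
  exact comp_eq_comp_dualIsogenyOver_of_transport e.symm D' D lam' lam hlam' α' β' α β hα' hβ' h'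

/-! #### With the transported `λ′ := lamTransport D D′ e e′ lam = e ≫ λ ≫ Ĥ_{e′}` -/

variable (e' : A.X ≅ A'.X) [IsMonHom e'.hom]

/-- The `λ`-clause of the transported polarisation map: `(e ≫ lam ≫ Ĥ_{e′}) ≫ Ĥ_e = e ≫ lam` (★ `hatTransport_comp_hatTransport`).
[cite: MumfordFogartyKirwan1994, Ch. 7 §2 Definition 7.3 (p. 130)] [cite: MilneAV2008, I §8 pp. 36–37] -/
theorem lamTransport_comp_hatTransportOver (he' : e'.hom = e.inv) (lam : A.X ⟶ D.hat.X) :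
    lamTransport D D' e e' lam ≫ hatTransportOver D D' e = e.hom ≫ lam := by
  have hH : hatTransportOver D' D e' ≫ hatTransportOver D D' e = 𝟙 _ :=
    Over.OverMorphism.ext (by
      rw [Over.comp_left, hatTransportOver_left, hatTransportOver_left, Over.id_left]
      exact hatTransport_comp_hatTransport D D' e e' he')
  change (e.hom ≫ lam ≫ hatTransportOver D' D e') ≫ hatTransportOver D D' e = e.hom ≫ lam
  rw [Category.assoc, Category.assoc, hH, Category.comp_id]

/-- **Rosati for the transported tuple `(A′, D′, e ≫ λ ≫ Ĥ_{e′})`** from Rosati for `(A, D, λ)`, `α′, β′` intertwined with `α, β` by `e`.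
[cite: MumfordFogartyKirwan1994, Ch. 7 §2 Definition 7.3 (p. 130)] [cite: RapoportSmithlingZhang2020Diagonal, §3.2] -/
theorem comp_eq_comp_dualIsogenyOver_lamTransport (he' : e'.hom = e.inv) (lam : A.X ⟶ D.hat.X)
    (α β : A.X ⟶ A.X) (α' β' : A'.X ⟶ A'.X) [IsMonHom β] [IsMonHom β']
    (hα : α' ≫ e.hom = e.hom ≫ α) (hβ : β' ≫ e.hom = e.hom ≫ β)
    (h : α ≫ lam = lam ≫ dualIsogenyOver β D D) :
    α' ≫ lamTransport D D' e e' lam = lamTransport D D' e e' lam ≫ dualIsogenyOver β' D' D' :=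
  comp_eq_comp_dualIsogenyOver_of_transport e D D' lam _ (lamTransport_comp_hatTransportOver e D D' e' he' lam) α β α' β' hα hβ h

end DualPair

/-! ### The `RGDInputsAt.rosati` shape: ring actions intertwined by `e` -/

section RingActionRosati

variable {S : Scheme.{u}} {A A' : AbelianSchemeOver S} (e : A'.X ≅ A.X) [IsMonHom e.hom] (D : A.DualPair) (D' : A'.DualPair)
  {O : Type*} [CommRing O] (act : A.RingAction O) (act' : A'.RingAction O)

/-- **ROSATI FOR RING ACTIONS IS TRANSPORTED ALONG AN EQUIVARIANT ISOMORPHISM OF TUPLES**: `act′.i a ≫ e = e ≫ act.i a` for all `a`,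
the `λ`-clause `lam′ ≫ Ĥ_e = e ≫ lam`; then `ι(b′) ≫ λ = λ ≫ ι(b)^∨` for `(A, act, D, lam)` gives the same for `(A′, act′, D′, lam′)`.
[cite: RapoportSmithlingZhang2020Diagonal, §3.2] [cite: Kottwitz1992, §5 (pp. 389–391)] [cite: MumfordFogartyKirwan1994, Ch. 7 §2 Definition 7.3 (p. 130)] -/
theorem RingAction.rosati_of_transport (hequiv : ∀ a, act'.i a ≫ e.hom = e.hom ≫ act.i a)
    (lam : A.X ⟶ D.hat.X) (lam' : A'.X ⟶ D'.hat.X) (hlam : lam' ≫ DualPair.hatTransportOver D D' e = e.hom ≫ lam) (b b' : O)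
    (h : haveI := act.isMonHom b
      act.i b' ≫ lam = lam ≫ DualPair.dualIsogenyOver (act.i b) D D) :
    haveI := act'.isMonHom b
    act'.i b' ≫ lam' = lam' ≫ DualPair.dualIsogenyOver (act'.i b) D' D' := by
  haveI := act.isMonHom b
  haveI := act'.isMonHom b
  exact DualPair.comp_eq_comp_dualIsogenyOver_of_transport e D D' lam lam' hlam (act.i b') (act.i b) (act'.i b') (act'.i b)
    (hequiv b') (hequiv b) h

/-- The same for the transported `λ′ := lamTransport D D′ e e′ lam`. [cite: RapoportSmithlingZhang2020Diagonal, §3.2] [cite: MumfordFogartyKirwan1994, Ch. 7 §2 Definition 7.3 (p. 130)] -/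
theorem RingAction.rosati_lamTransport (hequiv : ∀ a, act'.i a ≫ e.hom = e.hom ≫ act.i a)
    (e' : A.X ≅ A'.X) [IsMonHom e'.hom] (he' : e'.hom = e.inv) (lam : A.X ⟶ D.hat.X) (b b' : O)
    (h : haveI := act.isMonHom b
      act.i b' ≫ lam = lam ≫ DualPair.dualIsogenyOver (act.i b) D D) :
    haveI := act'.isMonHom b
    act'.i b' ≫ DualPair.lamTransport D D' e e' lam = DualPair.lamTransport D D' e e' lam ≫ DualPair.dualIsogenyOver (act'.i b) D' D' :=
  RingAction.rosati_of_transport e D D' act act' hequiv lam _ (DualPair.lamTransport_comp_hatTransportOver e D D' e' he' lam) b b' h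

end RingActionRosati

end AbelianSchemeOver

end Literature.AlgebraicGeometry.AbelianSchemes

end
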